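import HarnessLib
import Summits.RiemannHypothesis.RiemannHypothesis.Theorems.SignConePointwiseCheckerZ

/-!
# Route SignCone: soundness of the Z-table evaluator

Support for the unconditional rungs of `SignConeOscillatory` / `SignConeInequality`
(items stmt-RiemannHypothesis-16302 / 16301). The checks of `SignConePointwiseCheckerZ.lean` (comb and
correction evaluated from the one-pass table of unit-circle values) are sound for the corrected density
`F_D + H`: `point_boundZ` (via `point_bound_of_comb_le` of the fast checker), `gridFromZ_sound`,
`agrid₂Z_sound`, `chain₂Z_sound` and **`PWData.F_add_Hsos_nonneg_of_checksZ`** (same hypotheses as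
`F_add_Hsos_nonneg_of_checks`, grids checked with `checkAGrid₂Z`).
-/

noncomputable section

-- `Summit.RiemannHypothesis.RiemannHypothesis.…` repeats a namespace component by design (D-0017 layout).
set_option linter.dupNamespace false

open Real

namespace Summit.RiemannHypothesis.RiemannHypothesis.Theorems.SignCone

open Literature.Analysis.ValidatedNumerics.Numerics Literature.NumberTheory.LFunctions
open Literature.Analysis.SpecialFunctions (reDigammaQuarter reDigammaQuarter_mono reDigammaQuarter_even)

namespace PWData

variable {D : PWData}

/-- **Point bound (Z-table evaluation).** If `flTZ` returns `f` at `u` (genuine tables, covered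
correction list), then for every `y` with `w ≤ Re ψ(1/4 + iy/2)`: `f − slopeH·|y − u| ≤ F_D(y) + H(y)`. [folklore] -/
theorem point_boundZ {Y0 : ℚ} (h : D.checkScalars Y0 = true) {cs : List (FI × FI)} {logs : List FI}
    (ht : D.tablesOK cs logs = true) (fac : List (ℕ × ℕ)) {hl : List HTerm}
    (hhl : ∀ t ∈ hl, (1 ≤ t.p ∧ t.p ≤ D.logN) ∧ (1 ≤ t.q ∧ t.q ≤ D.logN))
    {w u f : ℚ} (hf : D.flTZ cs logs fac hl w u = some f) (y : ℝ)
    (hw : ((w : ℚ) : ℝ) ≤ reDigammaQuarter y) :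
    (f : ℝ) - D.slopeH logs hl * |y - u| ≤ D.F y + Hval hl y := by
  obtain ⟨-, -, hnd, hall, hlog, -⟩ := check_spec h
  have ht' := ht
  unfold tablesOK at ht'
  rw [Bool.and_eq_true, decide_eq_true_eq, decide_eq_true_eq] at ht'
  obtain ⟨hcs, hlogs⟩ := ht'
  subst hcs hlogs
  unfold flTZ at hf
  split at hf
  · rename_i Z0 W hZ hW
    simp only [Option.some.injEq] at hf
    subst hf
    -- the comb at `u` is below the upper end of its Z-table enclosure
    have hcomb := FI.le_hiQ (PW.mem_combZ hlog u fac D.a D.nodeList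
      (fun n hn => ⟨(hall n hn).2.2, (hall n hn).2.1⟩))
    rw [← List.sum_toFinset _ hnd] at hcomb
    have hp := point_bound_of_comb_le h hZ hW hcomb y hw
    -- H(u) ≥ its enclosure's lower end, and H is Lipschitz
    have hHu : (((PW.HZ hl (PW.ztable (FI.logTable D.logN) u fac D.logN)).loQ : ℚ) : ℝ) ≤ Hval hl u :=
      FI.loQ_le (PW.mem_HZ hlog u fac hl hhl)
    have hLip : Hval hl u - Hval hl y ≤ (PW.HlipQ (FI.logTable D.logN) hl : ℝ) * |y - u| := by
      rw [abs_sub_comm]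
      exact PW.Hval_sub_le hlog hl hhl u y
    unfold slopeH
    push_cast at hp ⊢
    nlinarith [hp, hHu, hLip, abs_nonneg (y - (u : ℝ))]
  · simp at hf

/-- **Soundness of the two-point cells (Z-table evaluation).** [folklore] -/
theorem gridFromZ_sound {Y0 : ℚ} (h : D.checkScalars Y0 = true) {cs : List (FI × FI)} {logs : List FI}
    (ht : D.tablesOK cs logs = true) {hl : List HTerm}
    (hhl : ∀ t ∈ hl, (1 ≤ t.p ∧ t.p ≤ D.logN) ∧ (1 ≤ t.q ∧ t.q ≤ D.logN)) (fac : List (ℕ × ℕ)) (w : ℚ) :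
    ∀ (rest : List ℚ) (u fu : ℚ), D.flTZ cs logs fac hl w u = some fu →
      (∀ y : ℝ, (u : ℝ) ≤ y → ((w : ℚ) : ℝ) ≤ reDigammaQuarter y) →
      D.checkGridFromZ cs logs fac hl (D.slopeH logs hl) w u fu rest = true →
      u ≤ lastQ (u :: rest) ∧ ∀ y : ℝ, (u : ℝ) ≤ y → y ≤ lastQ (u :: rest) → rest ≠ [] → 0 ≤ D.F y + Hval hl y
  | [], u, _, _, _, _ => ⟨le_of_eq (lastQ_singleton u).symm, fun _ _ _ hne => absurd rfl hne⟩
  | v :: rest, u, fu, hfu, hwu, hg => by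
    simp only [checkGridFromZ] at hg
    split at hg
    · rename_i fv hfv
      simp only [Bool.and_eq_true, decide_eq_true_eq] at hg
      obtain ⟨⟨huv, hcell⟩, hrest⟩ := hg
      have huv' : ((u : ℚ) : ℝ) ≤ v := by exact_mod_cast huv
      have hwv : ∀ y : ℝ, (v : ℝ) ≤ y → ((w : ℚ) : ℝ) ≤ reDigammaQuarter y :=
        fun y hy => hwu y (huv'.trans hy)
      have ih := gridFromZ_sound h ht hhl fac w rest v fv hfv hwv hrest
      rw [lastQ_cons_cons]
      refine ⟨huv.trans ih.1, fun y h1 h2 _ => ?_⟩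
      rcases le_or_gt y (v : ℝ) with hyv | hyv
      · have pu := point_boundZ h ht fac hhl hfu y (hwu y h1)
        have pv := point_boundZ h ht fac hhl hfv y (hwu y h1)
        have hc : (((v - u) * D.slopeH logs hl : ℚ) : ℝ) ≤ ((fu + fv : ℚ) : ℝ) := by exact_mod_cast hcell
        push_cast at hc
        rw [abs_of_nonneg (by linarith : (0 : ℝ) ≤ y - u)] at pu
        rw [abs_of_nonpos (by linarith : y - (v : ℝ) ≤ 0)] at pv
        nlinarith [pu, pv, hc]
      · rcases rest with _ | ⟨x, rest'⟩
        · rw [lastQ_singleton] at h2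
          exact absurd h2 (not_le.2 hyv)
        · exact ih.2 y hyv.le h2 (List.cons_ne_nil _ _)
    · simp at hg

/-- **Soundness of a passing anchored grid (Z-table evaluation)** `(w, u :: v :: r)`, `0 ≤ u`. [folklore] -/
theorem agrid₂Z_sound {Y0 : ℚ} (h : D.checkScalars Y0 = true) {cs : List (FI × FI)} {logs : List FI}
    (ht : D.tablesOK cs logs = true) {hl : List HTerm}
    (hhl : ∀ t ∈ hl, (1 ≤ t.p ∧ t.p ≤ D.logN) ∧ (1 ≤ t.q ∧ t.q ≤ D.logN)) {fac : List (ℕ × ℕ)} {w : ℚ}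
    {r : List ℚ} {u v : ℚ} (hu : 0 ≤ u) (hg : D.checkAGrid₂Z cs logs fac hl (w, u :: v :: r) = true) :
    u ≤ lastQ (u :: v :: r) ∧ ∀ y : ℝ, (u : ℝ) ≤ y → y ≤ lastQ (u :: v :: r) → 0 ≤ D.F y + Hval hl y := by
  simp only [checkAGrid₂Z, Bool.and_eq_true, decide_eq_true_eq] at hg
  obtain ⟨hw, hgrid⟩ := hg
  have hu' : (0 : ℝ) ≤ u := by exact_mod_cast hu
  have hwu : ∀ y : ℝ, (u : ℝ) ≤ y → ((w : ℚ) : ℝ) ≤ reDigammaQuarter y := fun y hy => by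
    have h1 : ((w : ℚ) : ℝ) ≤ ((wLoQ D.prec u (D.mwAt u) : ℚ) : ℝ) := by exact_mod_cast hw
    exact (h1.trans (wLoQ_le _ _ _)).trans (reDigammaQuarter_mono (by
      rw [abs_of_nonneg hu', abs_of_nonneg (hu'.trans hy)]; exact hy))
  simp only [checkGrid₂Z] at hgrid
  split at hgrid
  · rename_i fu hfu
    have hs := gridFromZ_sound h ht hhl fac w (v :: r) u fu hfu hwu hgrid
    exact ⟨hs.1, fun y h1 h2 => hs.2 y h1 h2 (List.cons_ne_nil _ _)⟩
  · simp at hgrid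

/-- **Anchored chain soundness (Z-table evaluation).** [folklore] -/
theorem chain₂Z_sound {Y1 Y0 : ℚ} (h : D.checkScalars Y1 = true) {cs : List (FI × FI)} {logs : List FI}
    (ht : D.tablesOK cs logs = true) {Z : SOSData} {hl : List HTerm} (hH : D.checkHTerms₂ Z hl = true)
    (htl : D.checkTailH Z Y0 = true) (fac : List (ℕ × ℕ)) :
    ∀ (gs : List (ℚ × List ℚ)) (st : ℚ), 0 ≤ st → chainOK (gs.map Prod.snd) st Y0 = true →
      (∀ g ∈ gs, D.checkAGrid₂Z cs logs fac hl g = true) →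
      st ≤ Y0 ∧ ∀ y : ℝ, (st : ℝ) ≤ y → y ≤ Y0 → 0 ≤ D.F y + Hval hl y
  | [], st, hst, hch, _ => by
    simp only [List.map_nil, chainOK, decide_eq_true_eq] at hch
    subst hch
    refine ⟨le_rfl, fun y h1 _ => ?_⟩
    rw [(checkHTerms₂_spec hH).1, SOSData.Hval_hlist₂ _ (checkHTerms₂_spec hH).2.2]
    exact tailH_sound h htl hst y h1
  | (w, pts) :: rest, st, hst, hch, hgs => by
    have hhl := (checkHTerms₂_spec hH).2.1
    simp only [List.map_cons, chainOK, Bool.and_eq_true, decide_eq_true_eq] at hch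
    obtain ⟨hhead, hrest⟩ := hch
    have hg : D.checkAGrid₂Z cs logs fac hl (w, pts) = true := hgs (w, pts) (by simp)
    have hgs' : ∀ g' ∈ rest, D.checkAGrid₂Z cs logs fac hl g' = true := fun g' hg' => hgs g' (by simp [hg'])
    match pts, hhead, hg with
    | [], hhead, _ => simp at hhead
    | [x], hhead, _ =>
      simp only [List.head?_cons, Option.some.injEq] at hhead
      subst hhead
      have ih := chain₂Z_sound h ht hH htl fac rest (lastQ [x]) (by simpa [lastQ] using hst) hrest hgs'
      simp only [lastQ] at ih
      exact ih
    | u :: v :: r, hhead, hg =>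
      simp only [List.head?_cons, Option.some.injEq] at hhead
      subst hhead
      have hgr := agrid₂Z_sound h ht hhl hst hg
      have ih := chain₂Z_sound h ht hH htl fac rest (lastQ (u :: v :: r)) (hst.trans hgr.1) hrest hgs'
      refine ⟨hgr.1.trans ih.1, fun y h1 h2 => ?_⟩
      rcases le_or_gt y (lastQ (u :: v :: r) : ℝ) with hy | hy
      · exact hgr.2 y h1 hy
      · exact ih.2 y hy.le h2

/-- **Soundness of the corrected pointwise checker, Z-table evaluation.** If the scalar checks pass for `Y₀`, the tables
check, the correction list is the certificate's (`checkHTerms₂`), the SOS tail check passes for `Y₀`, and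
a family of anchored grids whose point lists chain from `0` to `Y₀` passes grid by grid, then
`F_D(y) + Z.Hsos y ≥ 0` for every real `y`. [folklore] -/
theorem F_add_Hsos_nonneg_of_checksZ {Y1 Y0 : ℚ} (h : D.checkScalars Y1 = true) {cs : List (FI × FI)}
    {logs : List FI} (ht : D.tablesOK cs logs = true) {Z : SOSData} {hl : List HTerm}
    (hH : D.checkHTerms₂ Z hl = true) (htl : D.checkTailH Z Y0 = true) (fac : List (ℕ × ℕ))
    (gs : List (ℚ × List ℚ)) (hch : chainOK (gs.map Prod.snd) 0 Y0 = true)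
    (hgs : ∀ g ∈ gs, D.checkAGrid₂Z cs logs fac hl g = true) (y : ℝ) : 0 ≤ D.F y + Z.Hsos y := by
  rw [← SOSData.Hval_hlist₂ _ (checkHTerms₂_spec hH).2.2, ← (checkHTerms₂_spec hH).1]
  wlog hy : 0 ≤ y generalizing y with H
  · have := H (-y) (by linarith); rwa [F_add_Hval_neg] at this
  have hc := chain₂Z_sound h ht hH htl fac gs 0 le_rfl hch hgs
  rcases le_or_gt y (Y0 : ℝ) with hyY | hyY
  · exact hc.2 y (by exact_mod_cast hy) hyY
  · have := tailH_sound h htl hc.1 y hyY.le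
    rw [(checkHTerms₂_spec hH).1, SOSData.Hval_hlist₂ _ (checkHTerms₂_spec hH).2.2]
    exact this

end PWData

end Summit.RiemannHypothesis.RiemannHypothesis.Theorems.SignCone

end
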